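import Summits.RiemannHypothesis.RiemannHypothesis.Theorems.JensenLogBandShellEventually
import Literature.Analysis.InverseSpectral.HelicalFunctionProofsLattice
import Mathlib.Analysis.Complex.ExponentialBounds
import HarnessLib

/-!
# Numerical bookkeeping for the far zone of the top shell (BAND line, `stub_shellFar`)

RH ladder column JENSEN, rung J-P(P3) «log band», BAND crux `XiDerivBandRealAllRates` of route
«JensenLogBand», line «band-one-window» (u-arc, top-shell reshape), lead rh-jensen-prover g8.
RH-FREE real arithmetic. WHAT THIS IS NOT: nothing here bears on zeros of `ζ` or the truth of RH.

The window lemma (`LogBandArc.norm_xiSqArcU_sub_arcMainTerm_le`) and the competitor bound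
(`LogBandArc.norm_arcIntegrandU_competitor_le`) produce explicit error terms; here they are shown to be
`≤ 1/√k` resp. `≤ a₀/(2√k)` under explicit «eventually» hypotheses of the shape delivered by
`Theorems/JensenLogBandShellEventually.lean`:

* `window_bracket_le_inv_sqrt`: `W = 16(1+η)k/(Re w)² + η√(π/Re w) + 2e^{−Re w ψ₁²}/(Re w ψ₁) ≤ 1/√k`
  when `Re w ≥ 11k/40`, `η ≤ 1/50`, `650√k ≤ k` and `(240/(11ψ₁))·k²·e^{−(11ψ₁²/40)k} ≤ 1`;
* `exp_decay_of_gain`: `e^{−a₀(ℓ/2 − 1)} ≤ 2·e^{−(7a₀/4)k}` when `ℓ ≥ c(k−1)/2 − 3`, `c ≥ 7`, `a₀ ≤ 1/28`;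
* `far_junk_le`: `π·F + |h−r|·V + π·K ≤ a₀/(2√k)` for the flank, bridge and competitor terms, given
  the two exponential-decay hypotheses `A₁k²e^{−(ψ₁²/4)k} ≤ a₀/4`, `A₂k²e^{−(7a₀/4)k} ≤ a₀/4`.
-/

noncomputable section

-- single-problem summit: `Summit.RiemannHypothesis.RiemannHypothesis.…` is the tree convention
set_option linter.dupNamespace false

open Real

namespace Summit.RiemannHypothesis.RiemannHypothesis.Theorems.JensenPolynomials.LogBandArc

/-- `t ↦ (2/(tψ))·e^{−tψ²}` is bounded on `t ≥ t₀ > 0` by its value at `t₀`. [folklore] -/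
theorem tail_term_antitone {t t₀ ψ : ℝ} (ht₀ : 0 < t₀) (ht : t₀ ≤ t) (hψ : 0 < ψ) :
    2 / (t * ψ) * Real.exp (-t * ψ ^ 2) ≤ 2 / (t₀ * ψ) * Real.exp (-t₀ * ψ ^ 2) := by
  have ht0 : 0 < t := lt_of_lt_of_le ht₀ ht
  have h1 : 2 / (t * ψ) ≤ 2 / (t₀ * ψ) :=
    div_le_div_of_nonneg_left (by norm_num) (by positivity) (by nlinarith)
  have h2 : Real.exp (-t * ψ ^ 2) ≤ Real.exp (-t₀ * ψ ^ 2) :=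
    Real.exp_le_exp.2 (by nlinarith [sq_nonneg ψ])
  exact mul_le_mul h1 h2 (by positivity) (by positivity)

/-- **The window bracket is `≤ 1/√k`.** [folklore] -/
theorem window_bracket_le_inv_sqrt {k : ℕ} {Rw η ψ₁ : ℝ} (hk : 1 ≤ (k : ℝ))
    (hRw : 11 * (k : ℝ) / 40 ≤ Rw) (hη0 : 0 ≤ η) (hη : η ≤ 1 / 50) (hψ₁ : 0 < ψ₁)
    (hE1 : 650 * Real.sqrt k ≤ k)
    (hE2 : 240 / (11 * ψ₁) * (k : ℝ) ^ 2 * Real.exp (-(11 * ψ₁ ^ 2 / 40 * k)) ≤ 1) :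
    4 * (1 + η) * (4 * k) / Rw ^ 2 + η * Real.sqrt (π / Rw) + 2 / (Rw * ψ₁) * Real.exp (-Rw * ψ₁ ^ 2) ≤
      1 / Real.sqrt k := by
  have hk0 : (0 : ℝ) < k := by linarith
  have hRw0 : 0 < Rw := by linarith
  have hsk : 0 < Real.sqrt k := Real.sqrt_pos.2 hk0
  have hsk1 : 1 ≤ Real.sqrt k := by
    rw [show (1 : ℝ) = Real.sqrt 1 by simp]; exact Real.sqrt_le_sqrt hk
  have hsq : Real.sqrt k * Real.sqrt k = k := Real.mul_self_sqrt hk0.le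
  -- term 1: `16(1+η)k/Rw² ≤ 216/k ≤ 1/(3√k)`
  have h1 : 4 * (1 + η) * (4 * k) / Rw ^ 2 ≤ 1 / (3 * Real.sqrt k) := by
    have hA : 4 * (1 + η) * (4 * (k : ℝ)) / Rw ^ 2 ≤ 4 * (1 + η) * (4 * k) / (11 * k / 40) ^ 2 := by
      apply div_le_div_of_nonneg_left (by positivity) (by positivity)
      exact pow_le_pow_left₀ (by positivity) hRw 2
    refine hA.trans ?_
    rw [div_le_div_iff₀ (by positivity) (by positivity)]
    -- `16(1+η)k · 3√k ≤ (11k/40)²`: `48(1+η) k√k ≤ 49 k√k ≤ 49 k²/650 ≤ 121 k²/1600`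
    have hks : 0 ≤ (k : ℝ) * Real.sqrt k := by positivity
    have hA1 : 4 * (1 + η) * (4 * (k : ℝ)) * (3 * Real.sqrt k) = (48 * (1 + η)) * (k * Real.sqrt k) := by
      ring
    have hA2 : (48 * (1 + η)) * ((k : ℝ) * Real.sqrt k) ≤ 49 * (k * Real.sqrt k) :=
      mul_le_mul_of_nonneg_right (by linarith) hks
    have hA3 : 650 * ((k : ℝ) * Real.sqrt k) ≤ k * k := by
      have := mul_le_mul_of_nonneg_left hE1 hk0.le
      linarith [this]
    rw [hA1]
    nlinarith
  -- term 2: `η √(π/Rw) ≤ (1/50)·(3.5/√k) ≤ 1/(3√k)`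
  have h2 : η * Real.sqrt (π / Rw) ≤ 1 / (3 * Real.sqrt k) := by
    have hpi : π < 3.1416 := Real.pi_lt_d4
    have hB : π / Rw ≤ (49 / 4) / k := by
      rw [div_le_div_iff₀ hRw0 hk0]; nlinarith
    have hC : Real.sqrt (π / Rw) ≤ (7 / 2) / Real.sqrt k := by
      have : Real.sqrt ((49 / 4) / k) = (7 / 2) / Real.sqrt k := by
        rw [Real.sqrt_div (by norm_num), show (49 / 4 : ℝ) = (7 / 2) ^ 2 by norm_num,
          Real.sqrt_sq (by norm_num)]
      rw [← this]; exact Real.sqrt_le_sqrt hB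
    calc η * Real.sqrt (π / Rw) ≤ (1 / 50) * ((7 / 2) / Real.sqrt k) :=
          mul_le_mul hη hC (Real.sqrt_nonneg _) (by norm_num)
      _ = (7 / 100) / Real.sqrt k := by ring
      _ ≤ 1 / (3 * Real.sqrt k) := by
          rw [div_le_div_iff₀ hsk (by positivity)]; nlinarith
  -- term 3: by monotonicity in `Rw` and the decay hypothesis
  have h3 : 2 / (Rw * ψ₁) * Real.exp (-Rw * ψ₁ ^ 2) ≤ 1 / (3 * Real.sqrt k) := by
    have hmono := tail_term_antitone (by positivity : (0 : ℝ) < 11 * k / 40) hRw hψ₁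
    refine hmono.trans ?_
    -- `2/((11k/40)ψ₁) e^{−(11k/40)ψ₁²} = (1/(3k³)) · [(240/(11ψ₁)) k² e^{−…}] ≤ 1/(3k³) ≤ 1/(3√k)`
    have hexp_eq : Real.exp (-(11 * (k : ℝ) / 40) * ψ₁ ^ 2) = Real.exp (-(11 * ψ₁ ^ 2 / 40 * k)) := by
      congr 1; ring
    rw [hexp_eq]
    have hE : Real.exp (-(11 * ψ₁ ^ 2 / 40 * k)) ≤ 1 / (240 / (11 * ψ₁) * (k : ℝ) ^ 2) := by
      rw [le_div_iff₀ (by positivity)]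
      nlinarith [Real.exp_pos (-(11 * ψ₁ ^ 2 / 40 * k))]
    calc 2 / (11 * (k : ℝ) / 40 * ψ₁) * Real.exp (-(11 * ψ₁ ^ 2 / 40 * k))
        ≤ 2 / (11 * (k : ℝ) / 40 * ψ₁) * (1 / (240 / (11 * ψ₁) * (k : ℝ) ^ 2)) :=
          mul_le_mul_of_nonneg_left hE (by positivity)
      _ = 1 / (3 * (k : ℝ) ^ 3) := by field_simp; ring
      _ ≤ 1 / (3 * Real.sqrt k) := by
          apply div_le_div_of_nonneg_left (by norm_num) (by positivity)
          have hs_le : Real.sqrt k ≤ k := by nlinarith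
          nlinarith
  have hsum : 1 / (3 * Real.sqrt k) + 1 / (3 * Real.sqrt k) + 1 / (3 * Real.sqrt k) = 1 / Real.sqrt k := by
    field_simp; norm_num
  linarith

/-- **The gain factor**: `e^{−a(ℓ/2−1)} ≤ 2·e^{−(7a/4)k}` when `ℓ ≥ c(k−1)/2 − 3`, `c ≥ 7`,
`0 ≤ a ≤ 1/28`. [folklore] -/
theorem exp_decay_of_gain {a ℓ c : ℝ} {k : ℕ} (ha : 0 ≤ a) (ha1 : a ≤ 1 / 28) (hc : 7 ≤ c)
    (hk : (1 : ℝ) ≤ k) (hℓ : c * ((k : ℝ) - 1) / 2 - 3 ≤ ℓ) :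
    Real.exp (-(a * (ℓ / 2 - 1))) ≤ 2 * Real.exp (-(7 * a / 4 * k)) := by
  have h1 : 7 * (k : ℝ) / 4 - 17 / 4 ≤ ℓ / 2 - 1 := by nlinarith
  have h2 : Real.exp (-(a * (ℓ / 2 - 1))) ≤ Real.exp (-(a * (7 * (k : ℝ) / 4 - 17 / 4))) :=
    Real.exp_le_exp.2 (by nlinarith)
  refine h2.trans ?_
  have h3 : -(a * (7 * (k : ℝ) / 4 - 17 / 4)) = 17 * a / 4 + -(7 * a / 4 * k) := by ring
  rw [h3, Real.exp_add]
  apply mul_le_mul_of_nonneg_right _ (Real.exp_pos _).le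
  -- `e^{17a/4} ≤ e^{17/112} ≤ 1 + 2·(17/112) ≤ 2`
  have hx : |17 * a / 4| ≤ 1 := by rw [abs_le]; constructor <;> nlinarith
  have := Real.abs_exp_sub_one_le hx
  have h4 := (abs_le.1 this).2
  have h5 : |17 * a / 4| ≤ 1 / 2 := by rw [abs_le]; constructor <;> nlinarith
  linarith

/-- **The junk terms of the far zone are `≤ a₀/(2√k)`.** With `E = e^{14}`, `L = 1 + 4k` (a bound for
the logarithms `log(T + ·)`), `G = 2e^{−(7a₀/4)k}` (the gain), flank
`F ≤ E(1+1/a₀)e^{−(ψ₁²/4)k} + 672·L·E·G`, bridge `|h−r|·V ≤ 2·672·L·E·G·4`, competitor `K ≤ 672·L·E·G`: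
if `πE(1+1/a₀)·k²e^{−(ψ₁²/4)k} ≤ a₀/4` and `100800·E·k²·e^{−(7a₀/4)k} ≤ a₀/4` then the total is
`≤ a₀/(2√k)`. [folklore] -/
theorem far_junk_le {k : ℕ} {a₀ ψ₁ F VB K : ℝ} (hk : 1 ≤ (k : ℝ)) (ha₀ : 0 < a₀)
    (hF : F ≤ Real.exp 14 * (1 + 1 / a₀) * Real.exp (-(ψ₁ ^ 2 / 4 * k)) +
      672 * (1 + 4 * k) * Real.exp 14 * (2 * Real.exp (-(7 * a₀ / 4 * k))))
    (hVB : VB ≤ 2 * (672 * (1 + 4 * k) * Real.exp 14 * (2 * Real.exp (-(7 * a₀ / 4 * k)))) * 4)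
    (hK : K ≤ 672 * (1 + 4 * k) * Real.exp 14 * (2 * Real.exp (-(7 * a₀ / 4 * k))))
    (hC : π * Real.exp 14 * (1 + 1 / a₀) * (k : ℝ) ^ 2 * Real.exp (-(ψ₁ ^ 2 / 4 * k)) ≤ a₀ / 4)
    (hD : 100800 * Real.exp 14 * (k : ℝ) ^ 2 * Real.exp (-(7 * a₀ / 4 * k)) ≤ a₀ / 4) :
    π * F + VB + π * K ≤ a₀ / (2 * Real.sqrt k) := by
  have hk0 : (0 : ℝ) < k := by linarith
  have hsk : 0 < Real.sqrt k := Real.sqrt_pos.2 hk0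
  have hsq : Real.sqrt k * Real.sqrt k = k := Real.mul_self_sqrt hk0.le
  have hsk1 : 1 ≤ Real.sqrt k := by
    rw [show (1 : ℝ) = Real.sqrt 1 by simp]; exact Real.sqrt_le_sqrt hk
  have hs_le : Real.sqrt k ≤ k := by nlinarith
  have hpi : π < 3.1416 := Real.pi_lt_d4
  have hpi0 : 0 < π := Real.pi_pos
  set e1 : ℝ := Real.exp (-(ψ₁ ^ 2 / 4 * k)) with he1
  set e2 : ℝ := Real.exp (-(7 * a₀ / 4 * k)) with he2
  set E : ℝ := Real.exp 14 with hE
  have he1p : 0 < e1 := Real.exp_pos _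
  have he2p : 0 < e2 := Real.exp_pos _
  have hEp : 0 < E := Real.exp_pos _
  have ha₀' : 0 < 1 + 1 / a₀ := by have := one_div_pos.2 ha₀; linarith
  -- the two decaying pieces, in `1/√k` form
  have hT1 : π * E * (1 + 1 / a₀) * e1 ≤ a₀ / 4 / Real.sqrt k := by
    rw [le_div_iff₀ hsk]
    have : π * E * (1 + 1 / a₀) * e1 * Real.sqrt k ≤ π * E * (1 + 1 / a₀) * (k : ℝ) ^ 2 * e1 := by
      have hkk : Real.sqrt k ≤ (k : ℝ) ^ 2 := by nlinarith
      have hpos : 0 ≤ π * E * (1 + 1 / a₀) * e1 := by positivity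
      nlinarith
    linarith
  have hT2 : 100800 * E * (k : ℝ) * e2 ≤ a₀ / 4 / Real.sqrt k := by
    rw [le_div_iff₀ hsk]
    have : 100800 * E * (k : ℝ) * e2 * Real.sqrt k ≤ 100800 * E * (k : ℝ) ^ 2 * e2 := by
      have hpos : 0 ≤ 100800 * E * (k : ℝ) * e2 := by positivity
      nlinarith
    linarith
  -- collect: total ≤ π E (1+1/a₀) e1 + 672 (1+4k) E · 2 e2 · (π + 8 + π)
  have hL : (1 + 4 * (k : ℝ)) ≤ 5 * k := by linarith
  have hcollect : π * F + VB + π * K ≤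
      π * E * (1 + 1 / a₀) * e1 + 672 * (1 + 4 * k) * E * (2 * e2) * (2 * π + 8) := by
    have hpos : 0 ≤ 672 * (1 + 4 * (k : ℝ)) * E * (2 * e2) := by positivity
    nlinarith
  have hsecond : 672 * (1 + 4 * (k : ℝ)) * E * (2 * e2) * (2 * π + 8) ≤ 100800 * E * k * e2 := by
    have : 672 * (1 + 4 * (k : ℝ)) * E * (2 * e2) * (2 * π + 8) ≤
        672 * (5 * k) * E * (2 * e2) * 15 := by
      have h15 : 2 * π + 8 ≤ 15 := by linarith
      have hpos1 : 0 ≤ 672 * (1 + 4 * (k : ℝ)) * E * (2 * e2) := by positivity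
      have hpos2 : 0 ≤ E * (2 * e2) * 15 := by positivity
      nlinarith
    linarith
  have hfin : a₀ / 4 / Real.sqrt k + a₀ / 4 / Real.sqrt k = a₀ / (2 * Real.sqrt k) := by
    field_simp; ring
  linarith

end Summit.RiemannHypothesis.RiemannHypothesis.Theorems.JensenPolynomials.LogBandArc

end
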